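import Summits.HubbardSuperconductivity.HubbardSuperconductivity.Theses.ComplexGFFStiffness
import Summits.HubbardSuperconductivity.HubbardSuperconductivity.Theorems.ComplexGFFStiffnessDefs
import Summits.HubbardSuperconductivity.HubbardSuperconductivity.Theorems.ComplexGFFStiffnessHypACumulantZOfGNV
import Literature.MathematicalPhysics.StatisticalMechanics.TorusFRDHolds

/-!
# Line `gnv` — crux `HypACumulant` of route `route-HubbardSuperconductivity-ComplexGFFStiffness`

Crux item stmt-HubbardSuperconductivity-19154 (rank 2; decl
`Summit.HubbardSuperconductivity.HubbardSuperconductivity.Theses.ComplexGFFStiffness.HypACumulant`).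
Lead: prover-hubbard-h2gff-p1-g0-0 (2026-08-26).  Supersedes the birth skeleton `Lines/birth.lean`
(stubs `stub_zNonvanishing`, `stub_cumulantGivenZ`) by TRANSFERRING the first rung UP:

* `stub_zNonvanishing : ZNonvanishing` (N-uniform `Z_{L^N}(g,0) ≠ 0`) is no longer a stub: it is
  PROVED from the research stub `stub_gnv : GNV` by the landed reduction
  `…Theorems.ComplexGFF.zNonvanishing_of_gnv` (p448328 Defs, p448844 PertK, p449257 ZOfGNV): the model's single-site
  perturbation `𝒦_g = exp(−i g 𝒜) − 1`, `𝒜(z) = z_0(z_1²+z_2²+z_3²)`, lies in every ball of the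
  complexified `ι`-symmetric Adams–Buchholz–Kotecký–Müller space `E_{1/2,|·|²}` for small `g`
  (all derivatives `≤ g^{1/3}·B·e^{|z|²/4}`), and `Z_n(g,0) = pertZ n (pertK g)` on the nose.
* `GNV` (v1 stub `stub_gnv`; v2: `gnv_of_stubs` from `stub_frd` + `stub_gnvOfFrd`) — generalised non-vanishing: `∃ r₀ ∃ L₀ ∀ L odd ≥ L₀ ∃ ρ > 0 ∀ N ≥ 1 ∀ K`
  `ι`-admissible `(r₀, ρ)`: `∫ e^{−S_0} ∏_x (1 + K(∇φ(x))) ≠ 0` on `(ℤ/L^N)^4` — ABKM19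
  (arXiv:1910.13564) Theorem 2.2 / Ch. 4 (`𝒵 = ∫(1+K_N)dμ`, `‖K_N‖ ≤ Cη^N`), representation half,
  for COMPLEX `K` with `K(−z) = conj K(z)`.  Not in print; the line's bet is that every map of the
  printed renormalisation group (finite-range decomposition AKM13, polymer norms AKM16, the maps
  `T_k`, the fine-tuning `q(𝒦)` of Ch. 12) is `ι`-equivariant, so the tuned quadratic form stays
  real and the contraction estimates (Banach-algebra norms) are blind to complex coefficients.
* `stub_cumulantGivenZ : CumulantGivenZ` — unchanged (the smoothness half, `ℓ = 2`).

Why not the isotropic "dielectric-constant" trick (Dimock 2009, arXiv:0812.1765 Thm 1): the identity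
`∫ e^{−(1+σ)S_0 − igX_0} = (1+σ)^{−n⁴/2} Z_n(g(1+σ)^{−3/2},0)` is exact on our torus, but the Berry
vertex singles out the time axis and breaks lattice reflections, so the marginal quadratic form it
generates at second order is anisotropic (`q_00 ≠ q_jj`, off-diagonal `q_0j` allowed): a
one-parameter family cannot tune it; ABKM's matrix-valued family `μ^{(q)}` can, and the shift
`e^{−S_0} = e^{−S^{(q)}}·e^{+½Σ∇φ·q∇φ}` is an identity for every `q` — all of which is internal to
the proof of `GNV` (its statement fixes the reference form `|·|²`).

Registrar shape: `hypACumulant_of_stubs : GNV → CumulantGivenZ → <body of HypACumulant>` is a real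
proof (the landed `zNonvanishing_of_gnv`, then merge `L₀` by `max`, `g₀` by `min`); the target
`HypACumulant_of : HypACumulant` concludes the crux BY NAME; `sorry` occurs only in the
`stub_*` theorems, whose names and signatures are those a Theorems file
`ComplexGFFStiffnessHypACumulantStubFrd.lean` / `…StubGnvOfFrd.lean` / `…StubCumulantGivenZ.lean` must repeat verbatim
(namespace `Summit.HubbardSuperconductivity.HubbardSuperconductivity.Theorems.ComplexGFF`).
v2 (same session): `stub_gnv` is CUT into `stub_frd : TorusFRD 4` — the finite-range decomposition
of the torus Green's functions of the elliptic family `∇*A∇` with regularity in `A` and Fourier shell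
bounds, a PUBLISHED theorem (Buchholz 2018 Thm 2.4 = ABKM19 Thm 6.1) typed as the Literature named
fact `Literature.MathematicalPhysics.StatisticalMechanics.GradientFRD.TorusFRD` (statement landed;
dischargeable by a literature-prover: the tree already proves an algebraic Fejér–Chebyshev
finite-range decomposition, `Literature/Analysis/Matrix/FiniteRangeDecomposition.lean`, so only the
kernel-decay and Fourier-shell estimates remain) — and the research stub
`stub_gnvOfFrd : TorusFRD 4 → GNV` (polymers and norms AKM16 Ch. 4, the maps `T_k` and their
contraction ABKM19 Ch. 7–11, fine tuning Ch. 12, representation Ch. 4 — on the `ι`-symmetric complex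
class).  `GNV` itself is then the theorem `gnv_of_stubs`.

v3 (2026-08-27, literature seat `hubbard-h2gff-lit-1`): `stub_frd` is PROVED and is no longer a stub —
the named fact is discharged in Literature for every dimension,
`Literature.MathematicalPhysics.StatisticalMechanics.GradientFRD.TorusFRD_holds : ∀ d, TorusFRD d`
(`Literature/MathematicalPhysics/StatisticalMechanics/TorusFRDHolds.lean`, p485072; Buchholz 2018 Thm 2.4,
scalar case, 16 sorry-free modules), and `stub_frd := TorusFRD_holds 4` below.  Registered stubs after v3:
`stub_gnvOfFrd`, `stub_cumulantGivenZ` (the only `sorry`s of the file).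
-/

noncomputable section

-- `Summit.<Summit>.<Problem>`: single-conjunct summit, the duplicate component is mandated (D-0017).
set_option linter.dupNamespace false

namespace Summit.HubbardSuperconductivity.HubbardSuperconductivity.Theorems.ComplexGFF

open Literature.MathematicalPhysics.StatisticalMechanics.ComplexGradientGFF4 (Z ev Y D CumulantBoundAt)
open Summit.HubbardSuperconductivity.HubbardSuperconductivity.Theses.ComplexGFFStiffness (HypACumulant)

/-! ## Stub 1a `stub_frd` — PROVED (v3; no longer a registered stub) -/

/-- **Stub 1a — `stub_frd` (PROVED, v3).** The finite-range decomposition of the torus Green's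
functions of `∇*A∇`, `A ∈ 𝓛(ω₀, Ω₀)`, on `(ℤ/L^N)^4` with regularity in `A` and two-sided Fourier shell
bounds: Buchholz 2018 Thm 2.4 = ABKM19 Thm 6.1, the Literature named fact `GradientFRD.TorusFRD` at
`d = 4`, now a THEOREM by its Literature discharge `GradientFRD.TorusFRD_holds` (TorusFRDHolds.lean,
p485072). [cite: Buchholz2016, Thm 2.4] -/
theorem stub_frd : Literature.MathematicalPhysics.StatisticalMechanics.GradientFRD.TorusFRD 4 :=
  Literature.MathematicalPhysics.StatisticalMechanics.GradientFRD.TorusFRD_holds 4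

/-! ## The registered stubs (the ONLY `sorry`s of the file) -/

/-- **Stub 1b — `stub_gnvOfFrd` (OPEN; the research stub; size XL).** Given the finite-range
decomposition, generalised non-vanishing for `ι`-admissible complex single-site gradient
perturbations (`…Theorems.ComplexGFF.GNV`): ABKM19 Thm 2.2 (representation half, Ch. 4) ⊗ ℂ on the
`ι`-symmetric class — polymers and norms (AKM16 Ch. 4), the renormalisation maps `T_k` and the
contraction of their linearisation (ABKM19 Ch. 7–11), fine tuning of the quadratic form (Ch. 12; it
stays REAL because every map is `ι`-equivariant: Taylor coefficients of an `ι`-symmetric functional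
are real in even and imaginary in odd degree), and `𝒵 = ∫(1 + K_N)dμ`, `‖K_N‖ ≤ Cη^N`.  Why it might
fail: a hidden non-equivariant step (complex tuned form), or the typed `TorusFRD` lacking a clause
the printed proof consumes (then strengthen the fact, not the bet). -/
theorem stub_gnvOfFrd :
    Literature.MathematicalPhysics.StatisticalMechanics.GradientFRD.TorusFRD 4 → GNV := by
  sorry

/-- `GNV` from its cut: the PROVED `stub_frd` and the research stub `stub_gnvOfFrd` (bookkeeping). -/
theorem gnv_of_stubs : GNV := stub_gnvOfFrd stub_frd

/-- **Stub 2 — `stub_cumulantGivenZ` (OPEN; the smoothness half; size L; unchanged from the birth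
skeleton).** [ABKM19] Secs. 10–12: `C²` dependence of the renormalised free energy on the real
tilt `ε ↦ (1+𝒦_g)e^{εQ_u} − 1`, uniformly in `N`, given that the flow exists (recorded here by
`Z ≠ 0` along the tower). Why it might fail: the fine-tuned quadratic form must stay real on the
`ι`-symmetric class (route header: three loci). -/
theorem stub_cumulantGivenZ : CumulantGivenZ := by
  sorry

/-! ## Composition (sorry-free) and the registered target -/

/-- **Composition (kernel-checked, no `sorry` in its closure).** `GNV` and `CumulantGivenZ` imply
the crux statement — verbatim the body of
`Summit.HubbardSuperconductivity.HubbardSuperconductivity.Theses.ComplexGFFStiffness.HypACumulant`: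
`GNV → ZNonvanishing` is the landed reduction `zNonvanishing_of_gnv`; then merge the thresholds
(`L₀ := max`, `g₀ := min`) and feed the non-vanishing into the conditional cumulant bound. -/
theorem hypACumulant_of_stubs (h₁ : GNV) (h₂ : CumulantGivenZ) :
    ∃ L₀ : ℕ, ∀ L : ℕ, Odd L → L₀ ≤ L → ∃ g₀ C : ℝ, 0 < g₀ ∧ CumulantBoundAt L g₀ C := by
  obtain ⟨L₁, h₁⟩ := zNonvanishing_of_gnv h₁
  obtain ⟨L₂, h₂⟩ := h₂
  refine ⟨max L₁ L₂, fun L hL hle => ?_⟩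
  obtain ⟨g₁, hg₁, hZ⟩ := h₁ L hL (le_trans (le_max_left _ _) hle)
  obtain ⟨g₂, C, hg₂, hC⟩ := h₂ L hL (le_trans (le_max_right _ _) hle)
  refine ⟨min g₁ g₂, C, lt_min hg₁ hg₂, ?_⟩
  intro g hg0 hg N hN n _ hn
  have hz : Z n g 0 ≠ 0 := hZ g hg0 (le_trans hg (min_le_left _ _)) N hN n hn
  exact ⟨hz, hC g hg0 (le_trans hg (min_le_right _ _)) N hN n hn hz⟩

/-- **Registered target of the skeleton.** The crux BY NAME, no hypotheses: `hypACumulant_of_stubs`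
applied to the two declared stubs; `#print axioms HypACumulant_of` reaches `sorryAx` exactly
through `stub_gnvOfFrd` and `stub_cumulantGivenZ` (v3: `stub_frd` is proved). -/
theorem HypACumulant_of : HypACumulant :=
  hypACumulant_of_stubs gnv_of_stubs stub_cumulantGivenZ

end Summit.HubbardSuperconductivity.HubbardSuperconductivity.Theorems.ComplexGFF

end
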